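import Literature.Analysis.Convex.CopsonWeightedHardy
import HarnessLib

/-!
# Copson's weighted Hardy inequality on a decreasing nest of sets (dyadic Hardy counting)

The tail form of Copson's weighted Hardy inequality with `p = 2`
(`CopsonWeightedHardy.sum_mul_tailMean_sq_le`,
[cite: Bullen1998, Hardy's Inequality, Extensions (b) (Copson), eq. (3)]) applied to the annuli
`A_k = Q_k \ Q_{k+1}` (`k + 1 < K`), `A_{K-1} = Q_{K-1}` of a decreasing nest of measurable sets
`Q₀ ⊇ Q₁ ⊇ ⋯` of finite measure in a measure space `(X, μ)`, with weights `w_k = μ(A_k)` and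
values `a_k = ⨍_{A_k} h`: the tail weighted means are the box means `⨍_{Q_k} h`, and
`w_k a_k² = (∫_{A_k} h)² / μ(A_k) ≤ ∫_{A_k} h²` (Cauchy–Schwarz).  If the nest thins geometrically,
`μ(Q_{k+1}) ≤ r μ(Q_k)` with `0 ≤ r < 1`, then `μ(Q_k) ≤ μ(A_k) / (1 - r)` and one obtains the
**dyadic Hardy counting inequality**

`∑_{k < K} (∫_{Q_k} h)² / μ(Q_k) ≤ (4 / (1 - r)) ∫_{Q₀} h²`

(`sum_sq_setIntegral_div_measureReal_le`; `ℝ≥0∞`/`lintegral` form with no integrability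
hypothesis: `sum_sq_lintegral_enorm_div_measure_le`), the form in which Hardy's inequality is used to count
scales in square-function / Carleson-type estimates over dyadic boxes.  (For the record: the
sharp constant of this nested form is `(1 + √r)/(1 - √r)`, the supremum of the Toeplitz symbol
`∑ₙ r^{|n|/2}`; it is `3` for `r = 1/4` and `3 + 2√2` for `r = 1/2`.  Only the Copson bound
`4/(1 - r)` is proved here.)
-/

open MeasureTheory Set Finset
open scoped ENNReal

noncomputable section

namespace Literature.Analysis.Convex.CopsonWeightedHardy

variable {X : Type*} [MeasurableSpace X] {μ : Measure X}

/-- Cauchy–Schwarz on a set of finite measure: `(∫_A h)² ≤ μ(A) ∫_A h²` (via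
`0 ≤ ∫_A (h - t)²`). [folklore] -/
private theorem sq_setIntegral_le_measureReal_mul {A : Set X} (hμA : μ A ≠ ⊤) {h : X → ℝ}
    (hh : IntegrableOn h A μ) (hh2 : IntegrableOn (fun x => h x ^ 2) A μ) :
    (∫ x in A, h x ∂μ) ^ 2 ≤ μ.real A * ∫ x in A, h x ^ 2 ∂μ := by
  haveI : IsFiniteMeasure (μ.restrict A) :=
    ⟨by rw [Measure.restrict_apply_univ]; exact hμA.lt_top⟩
  have hM0 : 0 ≤ μ.real A := measureReal_nonneg
  -- the quadratic `t ↦ ∫_A (h - t)² ≥ 0`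
  have quad : ∀ t : ℝ,
      0 ≤ (∫ x in A, h x ^ 2 ∂μ) - 2 * t * (∫ x in A, h x ∂μ) + t ^ 2 * μ.real A := by
    intro t
    have i1 : Integrable (fun x => h x ^ 2 - 2 * t * h x) (μ.restrict A) :=
      hh2.sub (hh.const_mul (2 * t))
    have i2 : Integrable (fun x => 2 * t * h x) (μ.restrict A) := hh.const_mul (2 * t)
    have s1 : ∫ x in A, (h x - t) ^ 2 ∂μ = ∫ x in A, (h x ^ 2 - 2 * t * h x) + t ^ 2 ∂μ :=
      integral_congr_ae (ae_of_all _ fun x => by ring)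
    have e : ∫ x in A, (h x - t) ^ 2 ∂μ =
        (∫ x in A, h x ^ 2 ∂μ) - 2 * t * (∫ x in A, h x ∂μ) + t ^ 2 * μ.real A := by
      rw [s1, integral_add i1 (integrable_const _), integral_sub hh2 i2, integral_const_mul,
        setIntegral_const, smul_eq_mul]
      ring
    rw [← e]
    exact integral_nonneg fun x => sq_nonneg _
  by_cases hM' : μ.real A = 0
  · -- `μ A = 0`: the integral vanishes
    have hA0 : μ A = 0 := (measureReal_eq_zero_iff hμA).1 hM'
    have hI0 : ∫ x in A, h x ∂μ = 0 := setIntegral_measure_zero _ hA0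
    rw [hI0, hM']
    simp
  · have hMpos : 0 < μ.real A := lt_of_le_of_ne hM0 (Ne.symm hM')
    have hq := quad ((∫ x in A, h x ∂μ) / μ.real A)
    have e2 : (∫ x in A, h x ^ 2 ∂μ) - 2 * ((∫ x in A, h x ∂μ) / μ.real A) * (∫ x in A, h x ∂μ) +
        ((∫ x in A, h x ∂μ) / μ.real A) ^ 2 * μ.real A =
        (∫ x in A, h x ^ 2 ∂μ) - (∫ x in A, h x ∂μ) ^ 2 / μ.real A := by
      field_simp
      ring
    rw [e2] at hq
    have h3 : (∫ x in A, h x ∂μ) ^ 2 / μ.real A ≤ ∫ x in A, h x ^ 2 ∂μ := by linarith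
    rw [div_le_iff₀ hMpos] at h3
    linarith [mul_comm (∫ x in A, h x ^ 2 ∂μ) (μ.real A)]

/-- **Dyadic Hardy counting inequality** (Copson's weighted Hardy inequality, `p = 2`, tail form,
on the annuli of a nest).  Let `Q₀ ⊇ Q₁ ⊇ ⋯` be measurable sets of finite measure with
`μ(Q_{k+1}) ≤ r μ(Q_k)` for `k + 1 < K`, `0 ≤ r < 1`, and let `h`, `h²` be integrable on `Q₀`. Then
`∑_{k < K} (∫_{Q_k} h dμ)² / μ(Q_k) ≤ (4 / (1 - r)) ∫_{Q₀} h² dμ`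
(terms with `μ(Q_k) = 0` are `0`).  Bullen 1998, *Hardy's Inequality*, Extensions (b) eq. (3)
with `p = 2`, weights `μ(A_k)`, `A_k = Q_k \ Q_{k+1}`, plus Cauchy–Schwarz on each annulus.
[cite: Bullen1998, Hardy's Inequality, Extensions (b) (Copson), eq. (3)] -/
theorem sum_sq_setIntegral_div_measureReal_le {Q : ℕ → Set X} (hQm : ∀ k, MeasurableSet (Q k))
    (hanti : Antitone Q) (hfin : μ (Q 0) ≠ ⊤) {r : ℝ} (hr0 : 0 ≤ r) (hr1 : r < 1) (K : ℕ)
    (hratio : ∀ k, k + 1 < K → μ.real (Q (k + 1)) ≤ r * μ.real (Q k))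
    {h : X → ℝ} (hh : IntegrableOn h (Q 0) μ) (hh2 : IntegrableOn (fun x => h x ^ 2) (Q 0) μ) :
    ∑ k ∈ range K, (∫ x in Q k, h x ∂μ) ^ 2 / μ.real (Q k) ≤
      4 / (1 - r) * ∫ x in Q 0, h x ^ 2 ∂μ := by
  have h1r : 0 < 1 - r := by linarith
  have hJ0 : 0 ≤ ∫ x in Q 0, h x ^ 2 ∂μ := integral_nonneg fun x => sq_nonneg _
  rcases Nat.eq_zero_or_pos K with hK | hK
  · subst hK
    rw [range_zero, sum_empty]
    exact mul_nonneg (div_nonneg (by norm_num) h1r.le) hJ0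
  have hfinQ : ∀ k, μ (Q k) ≠ ⊤ := fun k =>
    ((measure_mono (hanti (Nat.zero_le k))).trans_lt hfin.lt_top).ne
  -- the annuli
  obtain ⟨A, hA⟩ : ∃ A : ℕ → Set X, ∀ j, A j = if j + 1 < K then Q j \ Q (j + 1) else Q j :=
    ⟨_, fun j => rfl⟩
  have hAsub : ∀ j, A j ⊆ Q j := by
    intro j
    by_cases hj : j + 1 < K
    · rw [hA j, if_pos hj]; exact sdiff_subset
    · rw [hA j, if_neg hj]
  have hAsub0 : ∀ j, A j ⊆ Q 0 := fun j => (hAsub j).trans (hanti (Nat.zero_le j))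
  have hAm : ∀ j, MeasurableSet (A j) := by
    intro j
    by_cases hj : j + 1 < K
    · rw [hA j, if_pos hj]; exact (hQm j).diff (hQm _)
    · rw [hA j, if_neg hj]; exact hQm j
  have hfinA : ∀ j, μ (A j) ≠ ⊤ := fun j =>
    ((measure_mono (hAsub0 j)).trans_lt hfin.lt_top).ne
  -- pairwise disjoint
  have hdisj : ∀ i j, i < j → j < K → Disjoint (A i) (A j) := by
    intro i j hij hjK
    have hi : i + 1 < K := by omega
    have h1 : A i ⊆ Q i \ Q (i + 1) := by rw [hA i, if_pos hi]
    have h2 : A j ⊆ Q (i + 1) := (hAsub j).trans (hanti (by omega))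
    exact Disjoint.mono h1 h2 disjoint_sdiff_left
  have hpair : ∀ k, Set.PairwiseDisjoint (↑(Finset.Ico k K) : Set ℕ) A := by
    intro k i hi j hj hne
    rw [coe_Ico, Set.mem_Ico] at hi hj
    rcases lt_or_gt_of_ne hne with hlt | hlt
    · exact hdisj i j hlt hj.2
    · exact (hdisj j i hlt hi.2).symm
  -- `⋃_{k ≤ j < K} A_j = Q_k`
  have hU : ∀ n k, k + n + 1 = K → (⋃ j ∈ Finset.Ico k K, A j) = Q k := by
    intro n
    induction n with
    | zero =>
      intro k hk
      have hIco : Finset.Ico k K = {k} := by rw [← hk, add_zero]; exact Nat.Ico_succ_singleton k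
      rw [hIco]
      simp only [Finset.mem_singleton, iUnion_iUnion_eq_left]
      rw [hA k, if_neg (by omega)]
    | succ n ih =>
      intro k hk
      have hkK : k < K := by omega
      have hk1 : k + 1 < K := by omega
      rw [← Finset.insert_Ico_add_one_left_eq_Ico hkK, set_biUnion_insert, ih (k + 1) (by omega)]
      rw [hA k, if_pos hk1]
      exact sdiff_union_of_subset (hanti (Nat.le_succ k))
  have hU' : ∀ k, k < K → (⋃ j ∈ Finset.Ico k K, A j) = Q k := fun k hk =>
    hU (K - 1 - k) k (by omega)
  -- box integrals and measures as tail sums over annuli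
  have hI : ∀ k, k < K → ∫ x in Q k, h x ∂μ = ∑ j ∈ Finset.Ico k K, ∫ x in A j, h x ∂μ := by
    intro k hk
    rw [← hU' k hk]
    exact integral_biUnion_finset _ (fun j _ => hAm j) (hpair k) fun j _ => hh.mono_set (hAsub0 j)
  have hMeas : ∀ k, k < K → μ.real (Q k) = ∑ j ∈ Finset.Ico k K, μ.real (A j) := by
    intro k hk
    rw [← hU' k hk]
    exact measureReal_biUnion_finset (hpair k) (fun j _ => hAm j) fun j _ => hfinA j
  -- thickness of the annuli: `(1 - r) μ(Q_k) ≤ μ(A_k)`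
  have hthick : ∀ k, k < K → (1 - r) * μ.real (Q k) ≤ μ.real (A k) := by
    intro k hk
    by_cases hk1 : k + 1 < K
    · have e : μ.real (A k) = μ.real (Q k) - μ.real (Q (k + 1)) := by
        rw [hA k, if_pos hk1]
        exact measureReal_sdiff (hanti (Nat.le_succ k)) (hQm _) (hfinQ _)
      rw [e]
      nlinarith [hratio k hk1]
    · rw [hA k, if_neg hk1]
      nlinarith [measureReal_nonneg (μ := μ) (s := Q k)]
  -- Copson's inequality (tail form) with weights `μ(A_j)` and values the annulus means
  have hw0 : ∀ j, 0 ≤ μ.real (A j) := fun j => measureReal_nonneg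
  have hwa : ∀ j, μ.real (A j) * ((∫ x in A j, h x ∂μ) / μ.real (A j)) = ∫ x in A j, h x ∂μ := by
    intro j
    by_cases h0 : μ.real (A j) = 0
    · have hz : μ (A j) = 0 := (measureReal_eq_zero_iff (hfinA j)).1 h0
      rw [h0, zero_mul]
      exact (setIntegral_measure_zero _ hz).symm
    · exact mul_div_cancel₀ _ h0
  have hC := sum_mul_tailMean_sq_le (a := fun j => (∫ x in A j, h x ∂μ) / μ.real (A j)) hw0 K
  simp only [hwa] at hC
  -- the tail means are the box means
  have hmean : ∀ k ∈ range K,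
      μ.real (A k) *
          ((∑ j ∈ Finset.Ico k K, ∫ x in A j, h x ∂μ) / ∑ j ∈ Finset.Ico k K, μ.real (A j)) ^ 2 =
        μ.real (A k) * ((∫ x in Q k, h x ∂μ) / μ.real (Q k)) ^ 2 := by
    intro k hk
    rw [Finset.mem_range] at hk
    rw [← hI k hk, ← hMeas k hk]
  -- annulus terms: `μ(A_k) (⨍_{A_k} h)² ≤ ∫_{A_k} h²`
  have hannulus : ∀ k ∈ range K,
      μ.real (A k) * ((∫ x in A k, h x ∂μ) / μ.real (A k)) ^ 2 ≤ ∫ x in A k, h x ^ 2 ∂μ := by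
    intro k _
    by_cases h0 : μ.real (A k) = 0
    · rw [h0, zero_mul]
      exact integral_nonneg fun x => sq_nonneg _
    · have hpos : 0 < μ.real (A k) := lt_of_le_of_ne measureReal_nonneg (Ne.symm h0)
      have hcs := sq_setIntegral_le_measureReal_mul (hfinA k) (hh.mono_set (hAsub0 k))
        (hh2.mono_set (hAsub0 k))
      have e : μ.real (A k) * ((∫ x in A k, h x ∂μ) / μ.real (A k)) ^ 2 =
          (∫ x in A k, h x ∂μ) ^ 2 / μ.real (A k) := by
        field_simp
      rw [e, div_le_iff₀ hpos]
      linarith [mul_comm (μ.real (A k)) (∫ x in A k, h x ^ 2 ∂μ)]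
  -- `∑_k ∫_{A_k} h² = ∫_{Q₀} h²`
  have hsumA : ∑ k ∈ range K, ∫ x in A k, h x ^ 2 ∂μ = ∫ x in Q 0, h x ^ 2 ∂μ := by
    rw [range_eq_Ico, ← integral_biUnion_finset _ (fun j _ => hAm j) (hpair 0)
      (fun j _ => hh2.mono_set (hAsub0 j)), hU' 0 hK]
  -- the target terms: `(∫_{Q_k} h)² / μ(Q_k) = μ(Q_k) (⨍_{Q_k} h)² ≤ μ(A_k) (⨍_{Q_k} h)² / (1 - r)`
  have hterm : ∀ k ∈ range K, (∫ x in Q k, h x ∂μ) ^ 2 / μ.real (Q k) ≤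
      (1 - r)⁻¹ * (μ.real (A k) * ((∫ x in Q k, h x ∂μ) / μ.real (Q k)) ^ 2) := by
    intro k hk
    rw [Finset.mem_range] at hk
    by_cases h0 : μ.real (Q k) = 0
    · rw [h0, div_zero, div_zero]
      simp
    · have hpos : 0 < μ.real (Q k) := lt_of_le_of_ne measureReal_nonneg (Ne.symm h0)
      have e : (∫ x in Q k, h x ∂μ) ^ 2 / μ.real (Q k) =
          μ.real (Q k) * ((∫ x in Q k, h x ∂μ) / μ.real (Q k)) ^ 2 := by
        field_simp
      rw [e]
      have hq : μ.real (Q k) ≤ (1 - r)⁻¹ * μ.real (A k) := by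
        rw [← div_eq_inv_mul, le_div_iff₀ h1r]
        linarith [hthick k hk]
      calc μ.real (Q k) * ((∫ x in Q k, h x ∂μ) / μ.real (Q k)) ^ 2
          ≤ (1 - r)⁻¹ * μ.real (A k) * ((∫ x in Q k, h x ∂μ) / μ.real (Q k)) ^ 2 :=
            mul_le_mul_of_nonneg_right hq (sq_nonneg _)
        _ = (1 - r)⁻¹ * (μ.real (A k) * ((∫ x in Q k, h x ∂μ) / μ.real (Q k)) ^ 2) := by ring
  -- assemble
  have hinv : 0 ≤ (1 - r)⁻¹ := inv_nonneg.2 h1r.le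
  calc ∑ k ∈ range K, (∫ x in Q k, h x ∂μ) ^ 2 / μ.real (Q k)
      ≤ ∑ k ∈ range K, (1 - r)⁻¹ * (μ.real (A k) * ((∫ x in Q k, h x ∂μ) / μ.real (Q k)) ^ 2) :=
        sum_le_sum hterm
    _ = (1 - r)⁻¹ * ∑ k ∈ range K,
          μ.real (A k) *
            ((∑ j ∈ Finset.Ico k K, ∫ x in A j, h x ∂μ) / ∑ j ∈ Finset.Ico k K, μ.real (A j)) ^ 2 := by
        rw [mul_sum]
        exact sum_congr rfl fun k hk => by rw [hmean k hk]
    _ ≤ (1 - r)⁻¹ * (4 * ∑ k ∈ range K, μ.real (A k) * ((∫ x in A k, h x ∂μ) / μ.real (A k)) ^ 2) :=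
        mul_le_mul_of_nonneg_left hC hinv
    _ ≤ (1 - r)⁻¹ * (4 * ∫ x in Q 0, h x ^ 2 ∂μ) := by
        rw [← hsumA]
        exact mul_le_mul_of_nonneg_left
          (mul_le_mul_of_nonneg_left (sum_le_sum hannulus) (by norm_num)) hinv
    _ = 4 / (1 - r) * ∫ x in Q 0, h x ^ 2 ∂μ := by ring

/-- **Dyadic Hardy counting inequality, `ℝ≥0∞` / `lintegral` form.**  For a decreasing nest of
measurable sets `Q₀ ⊇ Q₁ ⊇ ⋯` of finite measure with `μ(Q_{k+1}) ≤ r μ(Q_k)` (`k + 1 < K`,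
`0 ≤ r < 1`) and any a.e.-strongly measurable `h : X → E` on `Q₀` (no integrability needed: if
`∫_{Q₀} ‖h‖² = ∞` the bound is trivial),
`∑_{k < K} (∫⁻_{Q_k} ‖h‖ₑ)² / μ(Q_k) ≤ ofReal (4 / (1 - r)) · ∫⁻_{Q₀} ‖h‖ₑ²`
— the real inequality `sum_sq_setIntegral_div_measureReal_le` for `x ↦ ‖h x‖`
(Bullen 1998, *Hardy's Inequality*, Extensions (b) eq. (3), `p = 2`, on the annuli of the nest).
[cite: Bullen1998, Hardy's Inequality, Extensions (b) (Copson), eq. (3)] -/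
theorem sum_sq_lintegral_enorm_div_measure_le {E : Type*} [NormedAddCommGroup E] {Q : ℕ → Set X}
    (hQm : ∀ k, MeasurableSet (Q k)) (hanti : Antitone Q) (hfin : μ (Q 0) ≠ ⊤) {r : ℝ}
    (hr0 : 0 ≤ r) (hr1 : r < 1) (K : ℕ)
    (hratio : ∀ k, k + 1 < K → μ (Q (k + 1)) ≤ ENNReal.ofReal r * μ (Q k))
    {h : X → E} (hh : AEStronglyMeasurable h (μ.restrict (Q 0))) :
    ∑ k ∈ range K, (∫⁻ x in Q k, ‖h x‖ₑ ∂μ) ^ 2 / μ (Q k) ≤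
      ENNReal.ofReal (4 / (1 - r)) * ∫⁻ x in Q 0, ‖h x‖ₑ ^ 2 ∂μ := by
  have h1r : 0 < 1 - r := by linarith
  have h4 : 0 < 4 / (1 - r) := div_pos (by norm_num) h1r
  by_cases hL2 : ∫⁻ x in Q 0, ‖h x‖ₑ ^ 2 ∂μ = ⊤
  · rw [hL2, ENNReal.mul_top (ENNReal.ofReal_pos.2 h4).ne']
    exact le_top
  haveI : IsFiniteMeasure (μ.restrict (Q 0)) :=
    ⟨by rw [Measure.restrict_apply_univ]; exact hfin.lt_top⟩
  have hfinQ : ∀ k, μ (Q k) ≠ ⊤ := fun k =>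
    ((measure_mono (hanti (Nat.zero_le k))).trans_lt hfin.lt_top).ne
  -- the real data
  have henorm_sq : ∀ x, ‖‖h x‖ ^ 2‖ₑ = ‖h x‖ₑ ^ 2 := fun x => by
    rw [Real.enorm_eq_ofReal (sq_nonneg _), ENNReal.ofReal_pow (norm_nonneg _), ofReal_norm]
  have hn2 : IntegrableOn (fun x => ‖h x‖ ^ 2) (Q 0) μ := by
    refine ⟨(hh.norm.pow 2), ?_⟩
    show ∫⁻ x in Q 0, ‖‖h x‖ ^ 2‖ₑ ∂μ < ⊤
    simp_rw [henorm_sq]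
    exact lt_top_iff_ne_top.2 hL2
  have hL2' : MemLp h 2 (μ.restrict (Q 0)) := (memLp_two_iff_integrable_sq_norm hh).2 hn2
  have hn : IntegrableOn (fun x => ‖h x‖) (Q 0) μ := (hL2'.integrable one_le_two).norm
  have hratio' : ∀ k, k + 1 < K → μ.real (Q (k + 1)) ≤ r * μ.real (Q k) := by
    intro k hk
    have := ENNReal.toReal_mono (ENNReal.mul_ne_top ENNReal.ofReal_ne_top (hfinQ k)) (hratio k hk)
    rwa [ENNReal.toReal_mul, ENNReal.toReal_ofReal hr0] at this
  have hreal := sum_sq_setIntegral_div_measureReal_le hQm hanti hfin hr0 hr1 K hratio' hn hn2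
  -- conversions
  have hI : ∀ k, ∫⁻ x in Q k, ‖h x‖ₑ ∂μ = ENNReal.ofReal (∫ x in Q k, ‖h x‖ ∂μ) := by
    intro k
    rw [ofReal_integral_eq_lintegral_ofReal (hn.mono_set (hanti (Nat.zero_le k)))
      (ae_of_all _ fun x => norm_nonneg _)]
    simp_rw [ofReal_norm]
  have hJ : ∫⁻ x in Q 0, ‖h x‖ₑ ^ 2 ∂μ = ENNReal.ofReal (∫ x in Q 0, ‖h x‖ ^ 2 ∂μ) := by
    rw [ofReal_integral_eq_lintegral_ofReal hn2 (ae_of_all _ fun x => sq_nonneg _)]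
    refine lintegral_congr fun x => ?_
    rw [ENNReal.ofReal_pow (norm_nonneg _), ofReal_norm]
  have hterm : ∀ k ∈ range K, (∫⁻ x in Q k, ‖h x‖ₑ ∂μ) ^ 2 / μ (Q k) =
      ENNReal.ofReal ((∫ x in Q k, ‖h x‖ ∂μ) ^ 2 / μ.real (Q k)) := by
    intro k _
    have hI0 : 0 ≤ ∫ x in Q k, ‖h x‖ ∂μ := integral_nonneg fun x => norm_nonneg _
    rw [hI k, ← ofReal_measureReal (hfinQ k), ← ENNReal.ofReal_pow hI0]
    by_cases h0 : μ.real (Q k) = 0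
    · have hz : μ (Q k) = 0 := (measureReal_eq_zero_iff (hfinQ k)).1 h0
      have hIz : ∫ x in Q k, ‖h x‖ ∂μ = 0 := setIntegral_measure_zero _ hz
      rw [h0, hIz]
      simp
    · exact (ENNReal.ofReal_div_of_pos (lt_of_le_of_ne measureReal_nonneg (Ne.symm h0))).symm
  rw [sum_congr rfl hterm, ← ENNReal.ofReal_sum_of_nonneg fun k _ => div_nonneg (sq_nonneg _)
    measureReal_nonneg, hJ, ← ENNReal.ofReal_mul h4.le]
  exact ENNReal.ofReal_le_ofReal hreal

end Literature.Analysis.Convex.CopsonWeightedHardy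

end
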